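import Literature.MathematicalPhysics.QuantumLattice.WilsonDiracAP
import Summits.QuantumFields.QCD.Theorems.QuarksAsStableActionCriticalLineDiamagnetismStubHadamardUpper
import Summits.QuantumFields.QCD.Theorems.QuarksAsStableActionCriticalLineDiamagnetismStubFreeDetFormula
import Summits.QuantumFields.QCD.Theorems.QuarksAsStableActionCriticalLineDiamagnetismStubFreeSymbolSum
import Summits.QuantumFields.QCD.Theorems.QuarksAsStableActionCriticalLineDiamagnetismStubCellIncidence
import Summits.QuantumFields.QCD.Theorems.QuarksAsStableActionCriticalLineDiamagnetismStubQuarkChessboardOfSchwarz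
import Summits.QuantumFields.QCD.Theorems.QuarksAsStableActionCriticalLineDiamagnetismStubCellGainOfGauged
import Summits.QuantumFields.QCD.Theorems.QuarksAsStableActionCriticalLineDiamagnetismStubBlochFactorisation
import Summits.QuantumFields.QCD.Theorems.QuarksAsStableActionCriticalLineDiamagnetismStubFreeBlochBlocks
import Summits.QuantumFields.QCD.Theorems.QuarksAsStableActionCriticalLineDiamagnetismStubCellDetFactorisation
import Summits.QuantumFields.QCD.Theorems.QuarksAsStableActionCriticalLineDiamagnetismStubDetPerturbIR
import Summits.QuantumFields.QCD.Theorems.QuarksAsStableActionCriticalLineDiamagnetismStubLogDetSecondOrder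
import Summits.QuantumFields.QCD.Theorems.QuarksAsStableActionCriticalLineDiamagnetismStubDeltaBounds
import Summits.QuantumFields.QCD.Theorems.QuarksAsStableActionCriticalLineDiamagnetismStubBlochLatticeSum
import Summits.QuantumFields.QCD.Theorems.QuarksAsStableActionCriticalLineDiamagnetismStubTilingCellData
import Summits.QuantumFields.QCD.Theorems.QuarksAsStableActionCriticalLineDiamagnetismStubCellGainTilingGlue
import Summits.QuantumFields.QCD.Theorems.QuarksAsStableActionCriticalLineDiamagnetismStubBlockEstimate
import Summits.QuantumFields.QCD.Theorems.QuarksAsStableActionCriticalLineDiamagnetismStubCellGainCore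
import Summits.QuantumFields.QCD.Theorems.QuarksAsStableActionCriticalLineDiamagnetismStubCellRegauge
import Summits.QuantumFields.QCD.Theorems.QuarksAsStableActionCriticalLineDiamagnetismStubBackgroundSchwarz
import Summits.QuantumFields.QCD.Theorems.QuarksAsStableActionCriticalLineDiamagnetismStubTadpole
import Summits.QuantumFields.QCD.Theorems.QuarksAsStableActionCriticalLineDiamagnetismStubUnitaryCellIneq
import Summits.QuantumFields.QCD.Theorems.QuarksAsStableActionCriticalLineDiamagnetismStubBilinearBounds
import Summits.QuantumFields.QCD.Theorems.QuarksAsStableActionCriticalLineDiamagnetismStubOneLoopMarginOfAux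
import Summits.QuantumFields.QCD.Theorems.QuarksAsStableActionCriticalLineDiamagnetismStubTilingCombinatorics
import Summits.QuantumFields.QCD.Theorems.QuarksAsStableActionCriticalLineDiamagnetismStubTwistCounting
import Summits.QuantumFields.QCD.Theorems.QuarksAsStableActionCriticalLineDiamagnetismStubMassLipschitz
import Summits.QuantumFields.QCD.Theorems.QuarksAsStableActionCriticalLineDiamagnetismStubWardKernel
import Summits.QuantumFields.QCD.Theorems.QuarksAsStableActionCriticalLineDiamagnetismStubBlockMargin3b
import Summits.QuantumFields.QCD.Theorems.QuarksAsStableActionCriticalLineDiamagnetismStubBlockMargin0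
import Summits.QuantumFields.QCD.Theorems.QuarksAsStableActionCriticalLineDiamagnetismStubBlockMargin1
import Summits.QuantumFields.QCD.Theorems.QuarksAsStableActionCriticalLineDiamagnetismStubBlockMargin2
import Summits.QuantumFields.QCD.Theorems.QuarksAsStableActionCriticalLineDiamagnetismStubBlockMargin3a
import Summits.QuantumFields.QCD.Theorems.QuarksAsStableActionCriticalLineDiamagnetismStubGaugeCoercive
import Summits.QuantumFields.QCD.Theorems.QuarksAsStableActionCriticalLineDiamagnetismHessianMarginOfStubsAux
import Summits.QuantumFields.QCD.Theorems.QuarksAsStableActionCriticalLineDiamagnetismStubCornerCounting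
import Summits.QuantumFields.QCD.Theorems.QuarksAsStableActionCriticalLineDiamagnetismHessianMarginOfStubsAux2

/-!
# Stub Mg — `stub_hessianMargin`: the one-loop Hessian margin at the critical line (crux stmt-QuantumFields-9734, line `Sketch`, lead c3)

What. The registered stub `stub_hessianMargin` of the skeleton (`Lines/Sketch.lean`): for `M ≥ M₀`, `|m| ≤ ε`, the twisted
background `ω, ζ` of the `(2M)⁴` torus with period-`M` Bloch angles, and every anti-Hermitian tiling-odd link field `Y`,
`(1/2000 + c′)·M⁴·𝒦(Y) ≤ Q(Y)` (one-loop Hessian `Q`, linearised Wilson plaquette form `𝒦`).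

How. This is the skeleton's COMPOSITION v2 (`hessianMargin_of_stubsV2`, formerly proved in-skeleton and attached as evidence),
now a tree theorem because every input has landed: Ward kernel `stub_wardKernel` (p130817), gauge coercivity `stub_gaugeCoercive`
(p130928), mass Lipschitz `stub_massLipschitz` (p130805), twist counting `stub_twistCounting` (p130758), corner counting
`stub_cornerCounting` (p131847), the five pointwise block margins `stub_blockMargin0/1/2/3a/3b` (p137670, p137673, p137675,
p137676, p135165 — regions P0–P3a by the validated-numerics checker `…Checker*` and certificates `…CheckerCert0..3`, P3b analytic),
and the bookkeeping lemmas `…HessianMarginOfStubsAux/Aux2` (p131004, p131859/p131941). Witnesses: `c′ = 1/20000`,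
`ε = min εΣ (1/(5000(9·max CΣ 0 + 5)))`, `M₀ = max M₁ M₂`. Computational (depends on `native_decide` certificates upstream).
-/

noncomputable section

open scoped BigOperators Classical Matrix ComplexConjugate
open Finset
open Literature.MathematicalPhysics.QuantumLattice Literature.MathematicalPhysics.QuantumFieldTheory
  Literature.Probability.LatticeModels

namespace Summit.QuantumFields.QCD.Cruxes.CriticalLineDiamagnetism.ChessboardCellGain

/-! ### v14 (lead c3): the sub-skeleton of Mg `stub_hessianMargin`
`Mg ⟸ T (landed) + Bd (landed) + stub_freeBlochBlocks + stub_blochLatticeSum (landed) + MgW + MgK + MgM + MgN + P0 + P1 + P2 + P3`: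
(a) by T, `½Σ_μ T_μ‖Y‖²_μ = −½Σ_k ℓ_k(Y⋆Y)`, so Mg's right side is `Σ_k Q_k(Y)`, `Q_k(Y) := ½𝔅_k(Y,Y) − ½ℓ_k(Y⋆Y)` (block Hessian);
(b) MgW: `Q_k(Y) = Q_k(Y − dλ)` at every mass; MgK: choose `λ` with `8‖Y − dλ‖² ≤ 𝒦(Y)`; (c) MgM + `stub_freeBlochBlocks` (coercivity
`c(k) = min_s h_k(s)`) + `stub_blochLatticeSum` (at masses `m` and `0`, Young): `Σ_k |Q_{k,m}(Y) − Q_{k,0}(Y)| ≤ |m|·C_M M⁴·𝒦(Y)/8`;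
(d) at `m = 0` the twist `θ_k ∈ (0,π)⁴` of block `k` lies in exactly one region `ns ∈ {0, 1, 2, ≥3}`, so P0–P3 give `Q_{k,0}(Y) ≥ γ(θ_k)𝒦(Y)` with
`γ ∈ {3/2500, 13/20000, −1/4000, −1/1000}`, and MgN sums: `Σ_k γ(θ_k) ≥ (1/5·3/2500 + 39/100·13/20000 − 3/10·1/4000 − 11/100·1/1000)M⁴ ≥ (3/10000)M⁴`;
(e) `c′ := 1/10000`, `ε := min(ε_Σ, 1/(5000·C_M))` (mass slack `≤ 1/10000`), `M₀ := M₁`.  Numerics behind the constants: lead c3 folder `numerics/` (blocklam.py region table,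
regmin.py region minima, literal.py = position-space check of (a), MgW, MgK, MgM against the `let`s to 1e-15). -/

/-! ### Stub MgW — `stub_wardKernel`: LANDED (p130817, `…StubWardKernel.lean`; lead c3 wave 2). -/

/-! ### Stub MgK — `stub_gaugeCoercive`: LANDED (p130928, `…StubGaugeCoercive.lean`; lead c3 wave 2). -/

/-! ### Stub MgM — `stub_massLipschitz`: LANDED (p130805, `…StubMassLipschitz.lean`; lead c3 wave 2). -/

/-! ### Stub MgN — `stub_twistCounting`: LANDED (p130758, `…StubTwistCounting.lean`, M₁ = 1000; lead c3 wave 2). -/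




/-! ### Stub CC — `stub_cornerCounting`: LANDED (p131847, `…StubCornerCounting.lean`, M₂ = 1000; lead c3 v16). -/


/- v19 (lead c3, 2026-08-17): `stub_blockMargin0/1/2/3a` (P0–P3a) LANDED as `…Theorems.…StubBlockMargin0/1/2/3a`
   (block reduction + closed form + validated-numerics checker `…Checker*` + certificates `…CheckerCert0..3` by `native_decide`);
   the local sorried copies were removed and the imports added. The ONLY remaining stub is `stub_oddHalf`. -/

/- v18 (lead c3, 2026-08-17): `stub_blockMargin3b` (P3b corner box, claim −4) LANDED p135165 as
   `…Theorems.QuarksAsStableActionCriticalLineDiamagnetismStubBlockMargin3b` (assembly of stub_blockReduction p134526,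
   stub_blockClosedForm p134685, stub_cornerEntryBound p134169); the local sorried copy was removed and the import added. -/



open CellGainCore HessianMarginOf TilingCombinatorics in
/-- **Composition v2 `stub_hessianMarginOfStubsV2` : MgW → MgK → MgM → MgN → CC → P0 → P1 → P2 → P3a → P3b → Mg** — PROVED
(lead c3 worker; file `work/stubs/HessianMarginOfStubsV2.lean`, 327 lines, rc 0, evidence; aux lemmas LANDED p131004 `…HessianMarginOfStubsAux`,
p131859/p131941 `…HessianMarginOfStubsAux2` — `bookkeepingW` takes a general corner weight `w` and any `c′` with `c′ + w/500000 ≤ 217/2000000`, so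
further constant tweaks need no new lemma).  Witnesses `c′ = 1/20000`, `ε = min εΣ (1/(5000(9·max CΣ 0 + 5)))`, `M₀ = max M₁ M₂`; corner blocks by
`by_cases` on the corner predicate with `g_k = γ(ns k) − 4·[corner]`.  Not separately landable (14.3k-char hypothesis form); it lands inside
Mg's closing file once P0–P3b land. -/
theorem stub_hessianMarginOfStubsV2 : (∀ (m : ℝ) (θ : Fin 4 → ℝ) (u : Fin 4 → Matrix.unitaryGroup (Fin 3) ℂ), (∀ μ, ((u μ : Matrix.unitaryGroup (Fin 3) ℂ) : Matrix (Fin 3) (Fin 3) ℂ) = Complex.exp (↑(θ μ) * Complex.I) • (1 : Matrix (Fin 3) (Fin 3) ℂ)) → let B0 : Matrix (TorusSite 4 2 × Fin 3 × Fin 4) (TorusSite 4 2 × Fin 3 × Fin 4) ℂ := wilsonDirac (unitaryFundamentalRep (Fin 3) ℂ) (fun e : Edge 4 2 => u e.2) m 1; let Dl : (Edge 4 2 → Matrix (Fin 3) (Fin 3) ℂ) → Matrix (TorusSite 4 2 × Fin 3 × Fin 4) (TorusSite 4 2 × Fin 3 × Fin 4) ℂ := fun E => Matrix.of fun p q =>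 -(1 / 2 : ℂ) * ∑ μ : Fin 4, ((if q.1 = Site.shift p.1 μ then ((1 : Matrix (Fin 4) (Fin 4) ℂ) - euclideanGamma μ) p.2.2 q.2.2 * (((u μ : Matrix.unitaryGroup (Fin 3) ℂ) : Matrix (Fin 3) (Fin 3) ℂ) * E (p.1, μ)) p.2.1 q.2.1 else 0) + (if p.1 = Site.shift q.1 μ then ((1 : Matrix (Fin 4) (Fin 4) ℂ) + euclideanGamma μ) p.2.2 q.2.2 * (((u μ : Matrix.unitaryGroup (Fin 3) ℂ) : Matrix (Fin 3) (Fin 3) ℂ) * E (q.1, μ))ᴴ p.2.1 q.2.1 else 0)); let ell : (Edge 4 2 → Matrix (Fin 3) (Fin 3) ℂ) → ℝ := fun E => (B0⁻¹ * Dl E).trace.re; let bf : (Edge 4 2 → Matrix (Fin 3) (Fin 3) ℂ) → (Edge 4 2 → Matrix (Fin 3) (Fin 3) ℂ) → ℝ := fun E₁ E₂ => (B0⁻¹ * Dl E₁ * (B0⁻¹ * Dl E₂)).trace.re; ∀ (Y : Edge 4 2 → Matrix (Fin 3) (Fin 3) ℂ) (lam : TorusSite 4 2 → Matrix (Fin 3)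 (Fin 3) ℂ), (∀ e, (Y e)ᴴ = -Y e) → (∀ x, (lam x)ᴴ = -lam x) → bf Y (fun e => lam e.1 - lam (Site.shift e.1 e.2)) = ell (fun e => Y e * (lam e.1 - lam (Site.shift e.1 e.2)) + (lam e.1 - lam (Site.shift e.1 e.2)) * Y e) / 2) → (∀ Y : Edge 4 2 → Matrix (Fin 3) (Fin 3) ℂ, (∀ e, (Y e)ᴴ = -Y e) → (∀ (x : TorusSite 4 2) (μ : Fin 4), Y (Site.shift x μ, μ) = -Y (x, μ)) → ∃ lam : TorusSite 4 2 → Matrix (Fin 3) (Fin 3) ℂ, (∀ x, (lam x)ᴴ = -lam x) ∧ 8 * (∑ e : Edge 4 2, ∑ a, ∑ b, ‖(Y e - (lam e.1 - lam (Site.shift e.1 e.2))) a b‖ ^ 2) ≤ (∑ p : Plaquette 4 2, ∑ a, ∑ b, ‖(Y (p.1, p.2.1.1) + Y (Site.shift p.1 p.2.1.1, p.2.1.2) - Y (Site.shift p.1 p.2.1.2, p.2.1.1) - Y (p.1, p.2.1.2)) a b‖ ^ 2)) → (∀ (m : ℝ) (u : Fin 4 → Matrix.unitaryGroup (Fin 3)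 ℂ) (cm c0 : ℝ), 0 < cm → 0 < c0 → let Bm : Matrix (TorusSite 4 2 × Fin 3 × Fin 4) (TorusSite 4 2 × Fin 3 × Fin 4) ℂ := wilsonDirac (unitaryFundamentalRep (Fin 3) ℂ) (fun e : Edge 4 2 => u e.2) m 1; let Bz : Matrix (TorusSite 4 2 × Fin 3 × Fin 4) (TorusSite 4 2 × Fin 3 × Fin 4) ℂ := wilsonDirac (unitaryFundamentalRep (Fin 3) ℂ) (fun e : Edge 4 2 => u e.2) 0 1; let Dl : (Edge 4 2 → Matrix (Fin 3) (Fin 3) ℂ) → Matrix (TorusSite 4 2 × Fin 3 × Fin 4) (TorusSite 4 2 × Fin 3 × Fin 4) ℂ := fun E => Matrix.of fun p q => -(1 / 2 : ℂ) * ∑ μ : Fin 4, ((if q.1 = Site.shift p.1 μ then ((1 : Matrix (Fin 4) (Fin 4) ℂ) - euclideanGamma μ) p.2.2 q.2.2 * (((u μ : Matrix.unitaryGroup (Fin 3) ℂ) : Matrix (Fin 3) (Fin 3) ℂ) * E (p.1, μ)) p.2.1 q.2.1 else 0) + (if p.1 = Site.shift q.1 μ then ((1 : Matrix (Fin 4)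 (Fin 4) ℂ) + euclideanGamma μ) p.2.2 q.2.2 * (((u μ : Matrix.unitaryGroup (Fin 3) ℂ) : Matrix (Fin 3) (Fin 3) ℂ) * E (q.1, μ))ᴴ p.2.1 q.2.1 else 0)); (∀ v : TorusSite 4 2 × Fin 3 × Fin 4 → ℂ, cm * ∑ i, ‖v i‖ ^ 2 ≤ ∑ i, ‖(Bm.mulVec v) i‖ ^ 2) → (∀ v : TorusSite 4 2 × Fin 3 × Fin 4 → ℂ, c0 * ∑ i, ‖v i‖ ^ 2 ≤ ∑ i, ‖(Bz.mulVec v) i‖ ^ 2) → ∀ Y : Edge 4 2 → Matrix (Fin 3) (Fin 3) ℂ, |((Bm⁻¹ * Dl Y * (Bm⁻¹ * Dl Y)).trace.re / 2 - (Bm⁻¹ * Dl (fun e => Y e * Y e)).trace.re / 2) - ((Bz⁻¹ * Dl Y * (Bz⁻¹ * Dl Y)).trace.re / 2 - (Bz⁻¹ * Dl (fun e => Y e * Y e)).trace.re / 2)| ≤ |m| * (16 / (cm * Real.sqrt c0) + 16 / (c0 * Real.sqrt cm) + 40 / (Real.sqrt cm * Real.sqrt c0)) * (∑ e : Edge 4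 2, ∑ a, ∑ b, ‖Y e a b‖ ^ 2)) → (∃ M₁ : ℕ, ∀ (M : ℕ) [NeZero M], M₁ ≤ M → let ns : (Fin 4 → Fin M) → ℕ := fun k => (Finset.univ.filter (fun μ : Fin 4 => min (Real.pi * ((k μ : ℕ) : ℝ) / M + Real.pi / (2 * M)) (Real.pi - (Real.pi * ((k μ : ℕ) : ℝ) / M + Real.pi / (2 * M))) < 1 / 2)).card; (1 / 5 : ℝ) * (M : ℝ) ^ 4 ≤ ((Finset.univ.filter (fun k : Fin 4 → Fin M => ns k = 0)).card : ℝ) ∧ (39 / 100 : ℝ) * (M : ℝ) ^ 4 ≤ ((Finset.univ.filter (fun k : Fin 4 → Fin M => ns k = 1)).card : ℝ) ∧ ((Finset.univ.filter (fun k : Fin 4 → Fin M => ns k = 2)).card : ℝ) ≤ (3 / 10 : ℝ) * (M : ℝ) ^ 4 ∧ ((Finset.univ.filter (fun k : Fin 4 → Fin M => 3 ≤ ns k)).card : ℝ) ≤ (11 / 100 : ℝ) * (M : ℝ) ^ 4) → (∃ M₂ : ℕ, ∀ (M : ℕ) [NeZero M], M₂ ≤ M → ((Finset.univ.filter (fun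 k : Fin 4 → Fin M => ∀ μ : Fin 4, min (Real.pi * ((k μ : ℕ) : ℝ) / M + Real.pi / (2 * M)) (Real.pi - (Real.pi * ((k μ : ℕ) : ℝ) / M + Real.pi / (2 * M))) < 1 / 20)).card : ℝ) ≤ (1 / 500000 : ℝ) * (M : ℝ) ^ 4) → (∀ (θ : Fin 4 → ℝ), (∀ μ, 0 < θ μ ∧ θ μ < Real.pi) → (Finset.univ.filter (fun μ : Fin 4 => min (θ μ) (Real.pi - θ μ) < 1 / 2)).card = 0 → ∀ (u : Fin 4 → Matrix.unitaryGroup (Fin 3) ℂ), (∀ μ, ((u μ : Matrix.unitaryGroup (Fin 3) ℂ) : Matrix (Fin 3) (Fin 3) ℂ) = Complex.exp (↑(θ μ) * Complex.I) • (1 : Matrix (Fin 3) (Fin 3) ℂ)) → let B0 : Matrix (TorusSite 4 2 × Fin 3 × Fin 4) (TorusSite 4 2 × Fin 3 × Fin 4) ℂ := wilsonDirac (unitaryFundamentalRep (Fin 3) ℂ) (fun e : Edge 4 2 => u e.2) 0 1; let Dl : (Edge 4 2 → Matrix (Fin 3) (Fin 3) ℂ) → Matrix (TorusSite 4 2 ×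 Fin 3 × Fin 4) (TorusSite 4 2 × Fin 3 × Fin 4) ℂ := fun E => Matrix.of fun p q => -(1 / 2 : ℂ) * ∑ μ : Fin 4, ((if q.1 = Site.shift p.1 μ then ((1 : Matrix (Fin 4) (Fin 4) ℂ) - euclideanGamma μ) p.2.2 q.2.2 * (((u μ : Matrix.unitaryGroup (Fin 3) ℂ) : Matrix (Fin 3) (Fin 3) ℂ) * E (p.1, μ)) p.2.1 q.2.1 else 0) + (if p.1 = Site.shift q.1 μ then ((1 : Matrix (Fin 4) (Fin 4) ℂ) + euclideanGamma μ) p.2.2 q.2.2 * (((u μ : Matrix.unitaryGroup (Fin 3) ℂ) : Matrix (Fin 3) (Fin 3) ℂ) * E (q.1, μ))ᴴ p.2.1 q.2.1 else 0)); ∀ Y : Edge 4 2 → Matrix (Fin 3) (Fin 3) ℂ, (∀ e, (Y e)ᴴ = -Y e) → (∀ (x : TorusSite 4 2) (μ : Fin 4), Y (Site.shift x μ, μ) = -Y (x, μ)) → (3 / 2500 : ℝ) * (∑ p : Plaquette 4 2, ∑ a, ∑ b, ‖(Y (p.1, p.2.1.1) + Y (Site.shift p.1 p.2.1.1, p.2.1.2)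 - Y (Site.shift p.1 p.2.1.2, p.2.1.1) - Y (p.1, p.2.1.2)) a b‖ ^ 2) ≤ ((B0⁻¹ * Dl Y * (B0⁻¹ * Dl Y)).trace.re / 2 - (B0⁻¹ * Dl (fun e => Y e * Y e)).trace.re / 2)) → (∀ (θ : Fin 4 → ℝ), (∀ μ, 0 < θ μ ∧ θ μ < Real.pi) → (Finset.univ.filter (fun μ : Fin 4 => min (θ μ) (Real.pi - θ μ) < 1 / 2)).card = 1 → ∀ (u : Fin 4 → Matrix.unitaryGroup (Fin 3) ℂ), (∀ μ, ((u μ : Matrix.unitaryGroup (Fin 3) ℂ) : Matrix (Fin 3) (Fin 3) ℂ) = Complex.exp (↑(θ μ) * Complex.I) • (1 : Matrix (Fin 3) (Fin 3) ℂ)) → let B0 : Matrix (TorusSite 4 2 × Fin 3 × Fin 4) (TorusSite 4 2 × Fin 3 × Fin 4) ℂ := wilsonDirac (unitaryFundamentalRep (Fin 3) ℂ) (fun e : Edge 4 2 => u e.2) 0 1; let Dl : (Edge 4 2 → Matrix (Fin 3) (Fin 3) ℂ) → Matrix (TorusSite 4 2 × Fin 3 × Fin 4) (TorusSite 4 2 ×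 Fin 3 × Fin 4) ℂ := fun E => Matrix.of fun p q => -(1 / 2 : ℂ) * ∑ μ : Fin 4, ((if q.1 = Site.shift p.1 μ then ((1 : Matrix (Fin 4) (Fin 4) ℂ) - euclideanGamma μ) p.2.2 q.2.2 * (((u μ : Matrix.unitaryGroup (Fin 3) ℂ) : Matrix (Fin 3) (Fin 3) ℂ) * E (p.1, μ)) p.2.1 q.2.1 else 0) + (if p.1 = Site.shift q.1 μ then ((1 : Matrix (Fin 4) (Fin 4) ℂ) + euclideanGamma μ) p.2.2 q.2.2 * (((u μ : Matrix.unitaryGroup (Fin 3) ℂ) : Matrix (Fin 3) (Fin 3) ℂ) * E (q.1, μ))ᴴ p.2.1 q.2.1 else 0)); ∀ Y : Edge 4 2 → Matrix (Fin 3) (Fin 3) ℂ, (∀ e, (Y e)ᴴ = -Y e) → (∀ (x : TorusSite 4 2) (μ : Fin 4), Y (Site.shift x μ, μ) = -Y (x, μ)) → (13 / 20000 : ℝ) * (∑ p : Plaquette 4 2, ∑ a, ∑ b, ‖(Y (p.1, p.2.1.1) + Y (Site.shift p.1 p.2.1.1, p.2.1.2) - Y (Site.shift p.1 p.2.1.2,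 p.2.1.1) - Y (p.1, p.2.1.2)) a b‖ ^ 2) ≤ ((B0⁻¹ * Dl Y * (B0⁻¹ * Dl Y)).trace.re / 2 - (B0⁻¹ * Dl (fun e => Y e * Y e)).trace.re / 2)) → (∀ (θ : Fin 4 → ℝ), (∀ μ, 0 < θ μ ∧ θ μ < Real.pi) → (Finset.univ.filter (fun μ : Fin 4 => min (θ μ) (Real.pi - θ μ) < 1 / 2)).card = 2 → ∀ (u : Fin 4 → Matrix.unitaryGroup (Fin 3) ℂ), (∀ μ, ((u μ : Matrix.unitaryGroup (Fin 3) ℂ) : Matrix (Fin 3) (Fin 3) ℂ) = Complex.exp (↑(θ μ) * Complex.I) • (1 : Matrix (Fin 3) (Fin 3) ℂ)) → let B0 : Matrix (TorusSite 4 2 × Fin 3 × Fin 4) (TorusSite 4 2 × Fin 3 × Fin 4) ℂ := wilsonDirac (unitaryFundamentalRep (Fin 3) ℂ) (fun e : Edge 4 2 => u e.2) 0 1; let Dl : (Edge 4 2 → Matrix (Fin 3) (Fin 3) ℂ) → Matrix (TorusSite 4 2 × Fin 3 × Fin 4) (TorusSite 4 2 × Fin 3 × Fin 4) ℂ := fun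 E => Matrix.of fun p q => -(1 / 2 : ℂ) * ∑ μ : Fin 4, ((if q.1 = Site.shift p.1 μ then ((1 : Matrix (Fin 4) (Fin 4) ℂ) - euclideanGamma μ) p.2.2 q.2.2 * (((u μ : Matrix.unitaryGroup (Fin 3) ℂ) : Matrix (Fin 3) (Fin 3) ℂ) * E (p.1, μ)) p.2.1 q.2.1 else 0) + (if p.1 = Site.shift q.1 μ then ((1 : Matrix (Fin 4) (Fin 4) ℂ) + euclideanGamma μ) p.2.2 q.2.2 * (((u μ : Matrix.unitaryGroup (Fin 3) ℂ) : Matrix (Fin 3) (Fin 3) ℂ) * E (q.1, μ))ᴴ p.2.1 q.2.1 else 0)); ∀ Y : Edge 4 2 → Matrix (Fin 3) (Fin 3) ℂ, (∀ e, (Y e)ᴴ = -Y e) → (∀ (x : TorusSite 4 2) (μ : Fin 4), Y (Site.shift x μ, μ) = -Y (x, μ)) → -(1 / 4000 : ℝ) * (∑ p : Plaquette 4 2, ∑ a, ∑ b, ‖(Y (p.1, p.2.1.1) + Y (Site.shift p.1 p.2.1.1, p.2.1.2) - Y (Site.shift p.1 p.2.1.2, p.2.1.1) - Y (p.1, p.2.1.2))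 a b‖ ^ 2) ≤ ((B0⁻¹ * Dl Y * (B0⁻¹ * Dl Y)).trace.re / 2 - (B0⁻¹ * Dl (fun e => Y e * Y e)).trace.re / 2)) → (∀ (θ : Fin 4 → ℝ), (∀ μ, 0 < θ μ ∧ θ μ < Real.pi) → 3 ≤ (Finset.univ.filter (fun μ : Fin 4 => min (θ μ) (Real.pi - θ μ) < 1 / 2)).card → ¬ (∀ μ : Fin 4, min (θ μ) (Real.pi - θ μ) < 1 / 20) → ∀ (u : Fin 4 → Matrix.unitaryGroup (Fin 3) ℂ), (∀ μ, ((u μ : Matrix.unitaryGroup (Fin 3) ℂ) : Matrix (Fin 3) (Fin 3) ℂ) = Complex.exp (↑(θ μ) * Complex.I) • (1 : Matrix (Fin 3) (Fin 3) ℂ)) → let B0 : Matrix (TorusSite 4 2 × Fin 3 × Fin 4) (TorusSite 4 2 × Fin 3 × Fin 4) ℂ := wilsonDirac (unitaryFundamentalRep (Fin 3) ℂ) (fun e : Edge 4 2 => u e.2) 0 1; let Dl : (Edge 4 2 → Matrix (Fin 3) (Fin 3) ℂ) → Matrix (TorusSite 4 2 × Fin 3 × Fin 4) (TorusSite 4 2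 × Fin 3 × Fin 4) ℂ := fun E => Matrix.of fun p q => -(1 / 2 : ℂ) * ∑ μ : Fin 4, ((if q.1 = Site.shift p.1 μ then ((1 : Matrix (Fin 4) (Fin 4) ℂ) - euclideanGamma μ) p.2.2 q.2.2 * (((u μ : Matrix.unitaryGroup (Fin 3) ℂ) : Matrix (Fin 3) (Fin 3) ℂ) * E (p.1, μ)) p.2.1 q.2.1 else 0) + (if p.1 = Site.shift q.1 μ then ((1 : Matrix (Fin 4) (Fin 4) ℂ) + euclideanGamma μ) p.2.2 q.2.2 * (((u μ : Matrix.unitaryGroup (Fin 3) ℂ) : Matrix (Fin 3) (Fin 3) ℂ) * E (q.1, μ))ᴴ p.2.1 q.2.1 else 0)); ∀ Y : Edge 4 2 → Matrix (Fin 3) (Fin 3) ℂ, (∀ e, (Y e)ᴴ = -Y e) → (∀ (x : TorusSite 4 2) (μ : Fin 4), Y (Site.shift x μ, μ) = -Y (x, μ)) → -(1 / 1000 : ℝ) * (∑ p : Plaquette 4 2, ∑ a, ∑ b, ‖(Y (p.1, p.2.1.1) + Y (Site.shift p.1 p.2.1.1, p.2.1.2) - Y (Site.shift p.1 p.2.1.2,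 p.2.1.1) - Y (p.1, p.2.1.2)) a b‖ ^ 2) ≤ ((B0⁻¹ * Dl Y * (B0⁻¹ * Dl Y)).trace.re / 2 - (B0⁻¹ * Dl (fun e => Y e * Y e)).trace.re / 2)) → (∀ (θ : Fin 4 → ℝ), (∀ μ, 0 < θ μ ∧ θ μ < Real.pi) → (∀ μ : Fin 4, min (θ μ) (Real.pi - θ μ) < 1 / 20) → ∀ (u : Fin 4 → Matrix.unitaryGroup (Fin 3) ℂ), (∀ μ, ((u μ : Matrix.unitaryGroup (Fin 3) ℂ) : Matrix (Fin 3) (Fin 3) ℂ) = Complex.exp (↑(θ μ) * Complex.I) • (1 : Matrix (Fin 3) (Fin 3) ℂ)) → let B0 : Matrix (TorusSite 4 2 × Fin 3 × Fin 4) (TorusSite 4 2 × Fin 3 × Fin 4) ℂ := wilsonDirac (unitaryFundamentalRep (Fin 3) ℂ) (fun e : Edge 4 2 => u e.2) 0 1; let Dl : (Edge 4 2 → Matrix (Fin 3) (Fin 3) ℂ) → Matrix (TorusSite 4 2 × Fin 3 × Fin 4) (TorusSite 4 2 × Fin 3 × Fin 4) ℂ := fun E => Matrix.of fun p q => -(1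 / 2 : ℂ) * ∑ μ : Fin 4, ((if q.1 = Site.shift p.1 μ then ((1 : Matrix (Fin 4) (Fin 4) ℂ) - euclideanGamma μ) p.2.2 q.2.2 * (((u μ : Matrix.unitaryGroup (Fin 3) ℂ) : Matrix (Fin 3) (Fin 3) ℂ) * E (p.1, μ)) p.2.1 q.2.1 else 0) + (if p.1 = Site.shift q.1 μ then ((1 : Matrix (Fin 4) (Fin 4) ℂ) + euclideanGamma μ) p.2.2 q.2.2 * (((u μ : Matrix.unitaryGroup (Fin 3) ℂ) : Matrix (Fin 3) (Fin 3) ℂ) * E (q.1, μ))ᴴ p.2.1 q.2.1 else 0)); ∀ Y : Edge 4 2 → Matrix (Fin 3) (Fin 3) ℂ, (∀ e, (Y e)ᴴ = -Y e) → (∀ (x : TorusSite 4 2) (μ : Fin 4), Y (Site.shift x μ, μ) = -Y (x, μ)) → -(4 : ℝ) * (∑ p : Plaquette 4 2, ∑ a, ∑ b, ‖(Y (p.1, p.2.1.1) + Y (Site.shift p.1 p.2.1.1, p.2.1.2) - Y (Site.shift p.1 p.2.1.2, p.2.1.1) - Y (p.1, p.2.1.2)) a b‖ ^ 2) ≤ ((B0⁻¹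 * Dl Y * (B0⁻¹ * Dl Y)).trace.re / 2 - (B0⁻¹ * Dl (fun e => Y e * Y e)).trace.re / 2)) → (∃ c' ε : ℝ, 0 < c' ∧ 0 < ε ∧ ∃ M₀ : ℕ, ∀ (M : ℕ) [NeZero M], M₀ ≤ M → ∀ (m : ℝ), |m| ≤ ε → ∀ (ω : Matrix.unitaryGroup (Fin 3) ℂ) (ζ : (Fin 4 → Fin M) → Fin 4 → Matrix.unitaryGroup (Fin 3) ℂ), ((ω : Matrix.unitaryGroup (Fin 3) ℂ) : Matrix (Fin 3) (Fin 3) ℂ) = Complex.exp (↑(Real.pi / (2 * M : ℕ)) * Complex.I) • (1 : Matrix (Fin 3) (Fin 3) ℂ) → (∀ k μ, ((ζ k μ : Matrix.unitaryGroup (Fin 3) ℂ) : Matrix (Fin 3) (Fin 3) ℂ) = Complex.exp (Real.pi * Complex.I * ((k μ : ℕ) : ℂ) / (M : ℂ)) • (1 : Matrix (Fin 3) (Fin 3) ℂ)) → let B0 : (Fin 4 → Fin M) → Matrix (TorusSite 4 2 × Fin 3 × Fin 4) (TorusSite 4 2 × Fin 3 × Fin 4) ℂ := fun k => wilsonDirac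 (unitaryFundamentalRep (Fin 3) ℂ) (fun e : Edge 4 2 => ζ k e.2 * ω) m 1; let Dl : (Fin 4 → Fin M) → (Edge 4 2 → Matrix (Fin 3) (Fin 3) ℂ) → Matrix (TorusSite 4 2 × Fin 3 × Fin 4) (TorusSite 4 2 × Fin 3 × Fin 4) ℂ := fun k E => Matrix.of fun p q => -(1 / 2 : ℂ) * ∑ μ : Fin 4, ((if q.1 = Site.shift p.1 μ then ((1 : Matrix (Fin 4) (Fin 4) ℂ) - euclideanGamma μ) p.2.2 q.2.2 * (((ζ k μ * ω : Matrix.unitaryGroup (Fin 3) ℂ) : Matrix (Fin 3) (Fin 3) ℂ) * E (p.1, μ)) p.2.1 q.2.1 else 0) + (if p.1 = Site.shift q.1 μ then ((1 : Matrix (Fin 4) (Fin 4) ℂ) + euclideanGamma μ) p.2.2 q.2.2 * (((ζ k μ * ω : Matrix.unitaryGroup (Fin 3) ℂ) : Matrix (Fin 3) (Fin 3) ℂ) * E (q.1, μ))ᴴ p.2.1 q.2.1 else 0)); let ell : (Fin 4 → Fin M) → (Edge 4 2 → Matrix (Fin 3) (Fin 3) ℂ) → ℝ := fun k E => ((B0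 k)⁻¹ * Dl k E).trace.re; let bf : (Fin 4 → Fin M) → (Edge 4 2 → Matrix (Fin 3) (Fin 3) ℂ) → (Edge 4 2 → Matrix (Fin 3) (Fin 3) ℂ) → ℝ := fun k E₁ E₂ => ((B0 k)⁻¹ * Dl k E₁ * ((B0 k)⁻¹ * Dl k E₂)).trace.re; let tst : Fin 4 → (Edge 4 2 → Matrix (Fin 3) (Fin 3) ℂ) := fun μ e => if e = ((0 : TorusSite 4 2), μ) then (1 / 3 : ℂ) • (1 : Matrix (Fin 3) (Fin 3) ℂ) else 0; let T : Fin 4 → ℝ := fun μ => ∑ k : Fin 4 → Fin M, ell k (tst μ); ∀ Y : Edge 4 2 → Matrix (Fin 3) (Fin 3) ℂ, (∀ e, (Y e)ᴴ = -Y e) → (∀ (x : TorusSite 4 2) (μ : Fin 4), Y (Site.shift x μ, μ) = -Y (x, μ)) → c' * (M : ℝ) ^ 4 * (∑ p : Plaquette 4 2, ∑ a, ∑ b, ‖(Y (p.1, p.2.1.1) + Y (Site.shift p.1 p.2.1.1, p.2.1.2) - Y (Site.shift p.1 p.2.1.2, p.2.1.1) - Y (p.1, p.2.1.2)) a b‖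 ^ 2) ≤ (∑ k : Fin 4 → Fin M, bf k Y Y) / 2 + (∑ μ : Fin 4, T μ * ∑ x : TorusSite 4 2, ∑ a, ∑ b, ‖Y (x, μ) a b‖ ^ 2) / 2) := by
  intro hW hK hM hN hCC hP0 hP1 hP2 hP3a hP3b
  obtain ⟨CS, εS, hεS, hLS⟩ := stub_blochLatticeSum
  obtain ⟨M₁, hN⟩ := hN
  obtain ⟨M₂, hCC⟩ := hCC
  have hC5 : (0 : ℝ) < 9 * max CS 0 + 5 := by positivity
  refine ⟨1 / 20000, min εS (1 / (5000 * (9 * max CS 0 + 5))), by norm_num,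
    lt_min hεS (by positivity), max M₁ M₂, ?_⟩
  intro M _ hMM m hm ω ζ hω hζ B0 Dl ell bf tst T Y hYa hYo
  have hM1 : M₁ ≤ M := le_of_max_le_left hMM
  have hM2 : M₂ ≤ M := le_of_max_le_right hMM
  have hmS : |m| ≤ εS := hm.trans (min_le_left _ _)
  have hm5 : |m| * (9 * max CS 0 + 5) ≤ 1 / 5000 := by
    have hX : (9 * max CS 0 + 5) ≠ 0 := hC5.ne'
    calc |m| * (9 * max CS 0 + 5)
        ≤ 1 / (5000 * (9 * max CS 0 + 5)) * (9 * max CS 0 + 5) :=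
          mul_le_mul_of_nonneg_right (hm.trans (min_le_right _ _)) hC5.le
      _ = 1 / 5000 := by field_simp
  -- (1) the Bloch phases of the blocks
  set θ : (Fin 4 → Fin M) → Fin 4 → ℝ := fun k μ =>
    Real.pi * ((k μ : ℕ) : ℝ) / M + Real.pi / (2 * M)
  have hu : ∀ (k : Fin 4 → Fin M) (μ : Fin 4),
      (((fun ν => ζ k ν * ω) μ : Matrix.unitaryGroup (Fin 3) ℂ) : Matrix (Fin 3) (Fin 3) ℂ) =
        Complex.exp (↑(θ k μ) * Complex.I) • (1 : Matrix (Fin 3) (Fin 3) ℂ) :=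
    fun k μ => coe_zeta_mul_omega hω (hζ k μ)
  have hθk : ∀ (k : Fin 4 → Fin M) (μ : Fin 4), 0 < θ k μ ∧ θ k μ < Real.pi :=
    fun k μ => blochAngle_mem (k μ).isLt
  -- the free symbols at masses `m` and `0`, their minima, coercivity of the free blocks
  set hhm : (Fin 4 → Fin M) → (Fin 4 → ZMod 2) → ℝ := fun k s =>
    (m + ∑ μ : Fin 4, (1 - Real.cos (Real.pi * ((s μ).val : ℝ) + θ k μ))) ^ 2 +
      ∑ μ : Fin 4, Real.sin (Real.pi * ((s μ).val : ℝ) + θ k μ) ^ 2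
  set hh0 : (Fin 4 → Fin M) → (Fin 4 → ZMod 2) → ℝ := fun k s =>
    ((0 : ℝ) + ∑ μ : Fin 4, (1 - Real.cos (Real.pi * ((s μ).val : ℝ) + θ k μ))) ^ 2 +
      ∑ μ : Fin 4, Real.sin (Real.pi * ((s μ).val : ℝ) + θ k μ) ^ 2
  have hmin : ∀ f : (Fin 4 → ZMod 2) → ℝ, ∃ s₁, ∀ s, f s₁ ≤ f s := fun f => by
    obtain ⟨s₁, -, h⟩ := Finset.exists_min_image Finset.univ f Finset.univ_nonempty
    exact ⟨s₁, fun s => h s (Finset.mem_univ s)⟩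
  choose sm hsm using fun k => hmin (hhm k)
  choose s0 hs0 using fun k => hmin (hh0 k)
  set cm : (Fin 4 → Fin M) → ℝ := fun k => hhm k (sm k)
  set c0 : (Fin 4 → Fin M) → ℝ := fun k => hh0 k (s0 k)
  have hcm : ∀ k, 0 < cm k := fun k => symbol_pos m k (sm k)
  have hc0 : ∀ k, 0 < c0 k := fun k => symbol_pos 0 k (s0 k)
  set Bz : (Fin 4 → Fin M) →
      Matrix (TorusSite 4 2 × Fin 3 × Fin 4) (TorusSite 4 2 × Fin 3 × Fin 4) ℂ := fun k =>
    wilsonDirac (unitaryFundamentalRep (Fin 3) ℂ) (fun e : Edge 4 2 => ζ k e.2 * ω) 0 1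
  have hcoem : ∀ (k : Fin 4 → Fin M) (v : TorusSite 4 2 × Fin 3 × Fin 4 → ℂ),
      cm k * ∑ i, ‖v i‖ ^ 2 ≤ ∑ i, ‖((B0 k).mulVec v) i‖ ^ 2 := fun k =>
    (stub_freeBlochBlocks (θ k) m (fun ν => ζ k ν * ω) (hu k)).2 (cm k) (hsm k)
  have hcoe0 : ∀ (k : Fin 4 → Fin M) (v : TorusSite 4 2 × Fin 3 × Fin 4 → ℂ),
      c0 k * ∑ i, ‖v i‖ ^ 2 ≤ ∑ i, ‖((Bz k).mulVec v) i‖ ^ 2 := fun k =>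
    (stub_freeBlochBlocks (θ k) 0 (fun ν => ζ k ν * ω) (hu k)).2 (c0 k) (hs0 k)
  have hLSm : ∑ k, Real.sqrt (cm k) / cm k ^ 2 ≤ CS * (M : ℝ) ^ 4 :=
    calc ∑ k, Real.sqrt (cm k) / cm k ^ 2
        ≤ ∑ k : Fin 4 → Fin M, ∑ s : Fin 4 → ZMod 2, Real.sqrt (hhm k s) / hhm k s ^ 2 :=
          Finset.sum_le_sum fun k _ => Finset.single_le_sum
            (f := fun s => Real.sqrt (hhm k s) / hhm k s ^ 2)
            (fun s _ => div_nonneg (Real.sqrt_nonneg _) (sq_nonneg _)) (Finset.mem_univ (sm k))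
      _ ≤ CS * (M : ℝ) ^ 4 := hLS M m hmS
  have hLS0 : ∑ k, Real.sqrt (c0 k) / c0 k ^ 2 ≤ CS * (M : ℝ) ^ 4 :=
    calc ∑ k, Real.sqrt (c0 k) / c0 k ^ 2
        ≤ ∑ k : Fin 4 → Fin M, ∑ s : Fin 4 → ZMod 2, Real.sqrt (hh0 k s) / hh0 k s ^ 2 :=
          Finset.sum_le_sum fun k _ => Finset.single_le_sum
            (f := fun s => Real.sqrt (hh0 k s) / hh0 k s ^ 2)
            (fun s _ => div_nonneg (Real.sqrt_nonneg _) (sq_nonneg _)) (Finset.mem_univ (s0 k))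
      _ ≤ CS * (M : ℝ) ^ 4 := hLS M 0 (by rw [abs_zero]; exact hεS.le)
  -- (2) the tadpole: the right side is `Σ_k Q_k(Y)`
  have him : ∀ μ : Fin 4, (∑ x : TorusSite 4 2, (Y (x, μ) * Y (x, μ)).trace).im = 0 := fun μ => by
    rw [Complex.im_sum]
    exact Finset.sum_eq_zero fun x _ => im_trace_mul_self_of_conjTranspose _ (hYa _)
  have hre : ∀ μ : Fin 4, (∑ x : TorusSite 4 2, (Y (x, μ) * Y (x, μ)).trace).re =
      -∑ x : TorusSite 4 2, ∑ a, ∑ b, ‖Y (x, μ) a b‖ ^ 2 := fun μ => by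
    rw [Complex.re_sum, ← Finset.sum_neg_distrib]
    exact Finset.sum_congr rfl fun x _ => re_trace_mul_self_of_conjTranspose _ (hYa _)
  have hTk : ∀ k : Fin 4 → Fin M, ell k (fun e => Y e * Y e) =
      ∑ μ : Fin 4, ell k (tst μ) * (∑ x : TorusSite 4 2, (Y (x, μ) * Y (x, μ)).trace).re :=
    fun k => stub_tadpole m (θ k) (fun ν => ζ k ν * ω) (hu k) (fun e => Y e * Y e) him
  have hRHS : (∑ k : Fin 4 → Fin M, bf k Y Y) / 2 +
      (∑ μ : Fin 4, T μ * ∑ x : TorusSite 4 2, ∑ a, ∑ b, ‖Y (x, μ) a b‖ ^ 2) / 2 =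
      ∑ k : Fin 4 → Fin M, (bf k Y Y / 2 - ell k (fun e => Y e * Y e) / 2) := by
    have h1 : ∑ k : Fin 4 → Fin M, ell k (fun e => Y e * Y e) =
        -∑ μ : Fin 4, T μ * ∑ x : TorusSite 4 2, ∑ a, ∑ b, ‖Y (x, μ) a b‖ ^ 2 := by
      have h2 : ∀ k : Fin 4 → Fin M, ell k (fun e => Y e * Y e) =
          -∑ μ : Fin 4, ell k (tst μ) * ∑ x : TorusSite 4 2, ∑ a, ∑ b, ‖Y (x, μ) a b‖ ^ 2 :=
        fun k => by
        rw [hTk k, ← Finset.sum_neg_distrib]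
        exact Finset.sum_congr rfl fun μ _ => by rw [hre μ, mul_neg]
      calc ∑ k : Fin 4 → Fin M, ell k (fun e => Y e * Y e)
          = ∑ k : Fin 4 → Fin M, -∑ μ : Fin 4,
              ell k (tst μ) * ∑ x : TorusSite 4 2, ∑ a, ∑ b, ‖Y (x, μ) a b‖ ^ 2 :=
            Finset.sum_congr rfl fun k _ => h2 k
        _ = -∑ μ : Fin 4, ∑ k : Fin 4 → Fin M,
              ell k (tst μ) * ∑ x : TorusSite 4 2, ∑ a, ∑ b, ‖Y (x, μ) a b‖ ^ 2 := by
            rw [Finset.sum_neg_distrib, Finset.sum_comm]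
        _ = -∑ μ : Fin 4, T μ * ∑ x : TorusSite 4 2, ∑ a, ∑ b, ‖Y (x, μ) a b‖ ^ 2 :=
            congrArg Neg.neg (Finset.sum_congr rfl fun μ _ => (Finset.sum_mul _ _ _).symm)
    rw [Finset.sum_sub_distrib, ← Finset.sum_div, ← Finset.sum_div, h1]
    ring
  rw [hRHS]
  -- (3) the gauge: `Y' = Y − dλ`, `8‖Y'‖² ≤ 𝒦(Y) = 𝒦(Y')`, `Q_k(Y) = Q_k(Y')`
  obtain ⟨lam, hlam, hcoer⟩ := hK Y hYa hYo
  set D : Edge 4 2 → Matrix (Fin 3) (Fin 3) ℂ := fun e => lam e.1 - lam (Site.shift e.1 e.2)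
    with hD_def
  set Y' : Edge 4 2 → Matrix (Fin 3) (Fin 3) ℂ := fun e =>
    Y e - (lam e.1 - lam (Site.shift e.1 e.2)) with hY'_def
  set KY : ℝ := ∑ p : Plaquette 4 2, ∑ a, ∑ b, ‖(Y (p.1, p.2.1.1) +
    Y (Site.shift p.1 p.2.1.1, p.2.1.2) - Y (Site.shift p.1 p.2.1.2, p.2.1.1) -
      Y (p.1, p.2.1.2)) a b‖ ^ 2 with hKY_def
  set KY' : ℝ := ∑ p : Plaquette 4 2, ∑ a, ∑ b, ‖(Y' (p.1, p.2.1.1) +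
    Y' (Site.shift p.1 p.2.1.1, p.2.1.2) - Y' (Site.shift p.1 p.2.1.2, p.2.1.1) -
      Y' (p.1, p.2.1.2)) a b‖ ^ 2 with hKY'_def
  set nY' : ℝ := ∑ e : Edge 4 2, ∑ a, ∑ b, ‖Y' e a b‖ ^ 2 with hnY'_def
  have h8 : 8 * nY' ≤ KY := hcoer
  have hnY'0 : 0 ≤ nY' := by
    rw [hnY'_def]
    positivity
  have hY'a : ∀ e, (Y' e)ᴴ = -Y' e := fun e => by
    simp only [hY'_def, Matrix.conjTranspose_sub, hYa, hlam]
    abel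
  have hDa : ∀ e, (D e)ᴴ = -D e := fun e => by
    simp only [hD_def, Matrix.conjTranspose_sub, hlam]
    abel
  have hY'o : ∀ (x : TorusSite 4 2) (μ : Fin 4), Y' (Site.shift x μ, μ) = -Y' (x, μ) :=
    fun x μ => by
    simp only [hY'_def, shift_shift_self]
    rw [hYo]
    abel
  have hcurl : ∀ p : Plaquette 4 2, Y' (p.1, p.2.1.1) + Y' (Site.shift p.1 p.2.1.1, p.2.1.2) -
      Y' (Site.shift p.1 p.2.1.2, p.2.1.1) - Y' (p.1, p.2.1.2) = Y (p.1, p.2.1.1) +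
      Y (Site.shift p.1 p.2.1.1, p.2.1.2) - Y (Site.shift p.1 p.2.1.2, p.2.1.1) - Y (p.1, p.2.1.2) :=
    fun p => by
    simp only [hY'_def, shift_shift_comm p.1 p.2.1.2 p.2.1.1]
    abel
  have hKY' : KY' = KY := by
    rw [hKY'_def, hKY_def]
    exact Finset.sum_congr rfl fun p _ => by rw [hcurl p]
  have hDl_add : ∀ (k : Fin 4 → Fin M) (E₁ E₂ : Edge 4 2 → Matrix (Fin 3) (Fin 3) ℂ),
      Dl k (E₁ + E₂) = Dl k E₁ + Dl k E₂ := fun k =>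
    (stub_bilinearBounds m (fun ν => ζ k ν * ω) (cm k) (hcm k) (hcoem k)).1
  have hgauge : ∀ k : Fin 4 → Fin M, bf k Y Y / 2 - ell k (fun e => Y e * Y e) / 2 =
      bf k Y' Y' / 2 - ell k (fun e => Y' e * Y' e) / 2 := fun k =>
    hessian_gauge_invariance ((B0 k)⁻¹) (Dl k) (hDl_add k) Y D
      (hW m (θ k) (fun ν => ζ k ν * ω) (hu k) Y' lam hY'a hlam)
      (hW m (θ k) (fun ν => ζ k ν * ω) (hu k) D lam hDa hlam)
  -- (4) the mass: `|Q_{k,m}(Y') − Q_{k,0}(Y')| ≤ |m| β_k ‖Y'‖²`, `β_k ≤ 36 (t_m + t_0) + 40`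
  set Q0 : (Fin 4 → Fin M) → ℝ := fun k =>
    ((Bz k)⁻¹ * Dl k Y' * ((Bz k)⁻¹ * Dl k Y')).trace.re / 2 -
      ((Bz k)⁻¹ * Dl k (fun e => Y' e * Y' e)).trace.re / 2
  set β : (Fin 4 → Fin M) → ℝ := fun k =>
    16 / (cm k * Real.sqrt (c0 k)) + 16 / (c0 k * Real.sqrt (cm k)) +
      40 / (Real.sqrt (cm k) * Real.sqrt (c0 k))
  have hmass : ∀ k : Fin 4 → Fin M,
      |(bf k Y Y / 2 - ell k (fun e => Y e * Y e) / 2) - Q0 k| ≤ |m| * β k * nY' := fun k => by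
    rw [hgauge k]
    exact hM m (fun ν => ζ k ν * ω) (cm k) (c0 k) (hcm k) (hc0 k) (hcoem k) (hcoe0 k) Y'
  have hβ : ∀ k : Fin 4 → Fin M,
      β k ≤ 36 * (Real.sqrt (cm k) / cm k ^ 2 + Real.sqrt (c0 k) / c0 k ^ 2) + 40 :=
    fun k => massCoeff_le (hcm k) (hc0 k)
  -- (5) the regions at mass `0` (corner split for `ns ≥ 3`)
  have hKY'0 : 0 ≤ KY' := hKY'.symm ▸ (mul_nonneg (by norm_num : (0 : ℝ) ≤ 8) hnY'0).trans h8
  set ns : (Fin 4 → Fin M) → ℕ := fun k =>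
    (Finset.univ.filter (fun μ : Fin 4 => min (θ k μ) (Real.pi - θ k μ) < 1 / 2)).card
  set ic : (Fin 4 → Fin M) → ℝ := fun k =>
    if (∀ μ : Fin 4, min (θ k μ) (Real.pi - θ k μ) < 1 / 20) then 1 else 0 with hic_def
  have hic0 : ∀ k, 0 ≤ ic k := fun k => by
    simp only [hic_def]
    split_ifs <;> norm_num
  set g : (Fin 4 → Fin M) → ℝ := fun k =>
    3 / 2500 * (if ns k = 0 then 1 else 0) + 13 / 20000 * (if ns k = 1 then 1 else 0) -
      1 / 4000 * (if ns k = 2 then 1 else 0) - 1 / 1000 * (if 3 ≤ ns k then 1 else 0) -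
        4 * ic k with hg_def
  have hPk : ∀ k : Fin 4 → Fin M, g k * KY ≤ Q0 k := fun k => by
    rw [← hKY']
    rcases (show ns k = 0 ∨ ns k = 1 ∨ ns k = 2 ∨ 3 ≤ ns k by omega) with h | h | h | h
    · have hP : 3 / 2500 * KY' ≤ Q0 k :=
        hP0 (θ k) (hθk k) h (fun ν => ζ k ν * ω) (hu k) Y' hY'a hY'o
      have hg : g k ≤ 3 / 2500 := by
        have : g k = 3 / 2500 - 4 * ic k := by
          simp only [hg_def, h]
          norm_num
        linarith [hic0 k]
      exact (mul_le_mul_of_nonneg_right hg hKY'0).trans hP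
    · have hP : 13 / 20000 * KY' ≤ Q0 k :=
        hP1 (θ k) (hθk k) h (fun ν => ζ k ν * ω) (hu k) Y' hY'a hY'o
      have hg : g k ≤ 13 / 20000 := by
        have : g k = 13 / 20000 - 4 * ic k := by
          simp only [hg_def, h]
          norm_num
        linarith [hic0 k]
      exact (mul_le_mul_of_nonneg_right hg hKY'0).trans hP
    · have hP : -(1 / 4000) * KY' ≤ Q0 k :=
        hP2 (θ k) (hθk k) h (fun ν => ζ k ν * ω) (hu k) Y' hY'a hY'o
      have hg : g k ≤ -(1 / 4000) := by
        have : g k = -(1 / 4000) - 4 * ic k := by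
          simp only [hg_def, h]
          norm_num
        linarith [hic0 k]
      exact (mul_le_mul_of_nonneg_right hg hKY'0).trans hP
    · have hg' : g k = -(1 / 1000) - 4 * ic k := by
        simp only [hg_def, if_neg (by omega : ¬ns k = 0), if_neg (by omega : ¬ns k = 1),
          if_neg (by omega : ¬ns k = 2), if_pos h]
        norm_num
      by_cases hc : ∀ μ : Fin 4, min (θ k μ) (Real.pi - θ k μ) < 1 / 20
      · have hP : -(4 : ℝ) * KY' ≤ Q0 k :=
          hP3b (θ k) (hθk k) hc (fun ν => ζ k ν * ω) (hu k) Y' hY'a hY'o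
        have hic : ic k = 1 := by simp only [hic_def, if_pos hc]
        have hg : g k ≤ -(4 : ℝ) := by linarith
        exact (mul_le_mul_of_nonneg_right hg hKY'0).trans hP
      · have hP : -(1 / 1000) * KY' ≤ Q0 k :=
          hP3a (θ k) (hθk k) h hc (fun ν => ζ k ν * ω) (hu k) Y' hY'a hY'o
        have hic : ic k = 0 := by simp only [hic_def, if_neg hc]
        have hg : g k ≤ -(1 / 1000) := by linarith
        exact (mul_le_mul_of_nonneg_right hg hKY'0).trans hP
  -- (6) counting and bookkeeping
  obtain ⟨hN0, hN1, hN2, hN3⟩ :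
      (1 / 5 : ℝ) * (M : ℝ) ^ 4 ≤ ((Finset.univ.filter (fun k : Fin 4 → Fin M => ns k = 0)).card : ℝ) ∧
      (39 / 100 : ℝ) * (M : ℝ) ^ 4 ≤
        ((Finset.univ.filter (fun k : Fin 4 → Fin M => ns k = 1)).card : ℝ) ∧
      ((Finset.univ.filter (fun k : Fin 4 → Fin M => ns k = 2)).card : ℝ) ≤ (3 / 10 : ℝ) * (M : ℝ) ^ 4 ∧
      ((Finset.univ.filter (fun k : Fin 4 → Fin M => 3 ≤ ns k)).card : ℝ) ≤
        (11 / 100 : ℝ) * (M : ℝ) ^ 4 :=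
    hN M hM1
  have hNc : ((Finset.univ.filter (fun k : Fin 4 → Fin M =>
      ∀ μ : Fin 4, min (θ k μ) (Real.pi - θ k μ) < 1 / 20)).card : ℝ) ≤
        (1 / 500000 : ℝ) * (M : ℝ) ^ 4 :=
    hCC M hM2
  have hic_sum : ∑ k, ic k = ((Finset.univ.filter (fun k : Fin 4 → Fin M =>
      ∀ μ : Fin 4, min (θ k μ) (Real.pi - θ k μ) < 1 / 20)).card : ℝ) := by
    simp only [hic_def, Finset.sum_boole]
  have hg_sum : ∑ k, g k =
      3 / 2500 * ((Finset.univ.filter (fun k : Fin 4 → Fin M => ns k = 0)).card : ℝ) +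
      13 / 20000 * ((Finset.univ.filter (fun k : Fin 4 → Fin M => ns k = 1)).card : ℝ) -
      1 / 4000 * ((Finset.univ.filter (fun k : Fin 4 → Fin M => ns k = 2)).card : ℝ) -
      1 / 1000 * ((Finset.univ.filter (fun k : Fin 4 → Fin M => 3 ≤ ns k)).card : ℝ) -
      4 * ((Finset.univ.filter (fun k : Fin 4 → Fin M =>
        ∀ μ : Fin 4, min (θ k μ) (Real.pi - θ k μ) < 1 / 20)).card : ℝ) := by
    rw [← hic_sum]
    simp only [hg_def, Finset.sum_add_distrib, Finset.sum_sub_distrib, ← Finset.mul_sum,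
      Finset.sum_boole]
  have hcard : ∑ _k : Fin 4 → Fin M, (1 : ℝ) = (M : ℝ) ^ 4 := by
    rw [Finset.sum_const, Finset.card_univ, Fintype.card_fun, Fintype.card_fin, Fintype.card_fin,
      nsmul_eq_mul, mul_one, Nat.cast_pow]
  exact bookkeepingW hmass hPk hβ hLSm hLS0 hcard h8 hnY'0 hg_sum hN0 hN1 hN2 hN3 hNc
    (by norm_num) hm5 (by positivity) (by norm_num)

/-- **Stub Mg — `hessianMargin` (v11 residual; from v14 DERIVED from MgW, MgK, MgM, MgN, P0–P3 by the composition `stub_hessianMarginOfStubs` above).**  The finite-`M` one-loop Hessian form of the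
blocks, `𝓗_M(Y) = ½ Σ_k 𝔅_k(Y,Y) + ½ Σ_μ T_μ Σ_x ‖Y(x,μ)‖_F²` with `T_μ = Σ_k ℓ_k(tst_μ)` (the tadpole coefficient), dominates
`c′ M⁴ Σ_p ‖curl Y_p‖_F²` on anti-Hermitian, tiling-odd (`Y(x+μ̂,μ) = −Y(x,μ)`) block link fields, for `M ≥ M₀`, `|m| ≤ ε`.
Content: `−𝓗_M` is the exact second variation at `W = 1` of `Σ_k log|det B_k(W)|` along `W = e^{Y}`; it is exactly gauge
invariant (Ward: `Δ_k(dλ) = [Λ, B⁰_k]`) and block-diagonal in the period-2 momentum; per momentum class with `n ∈ {2,3,4}`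
active directions it is `a_n(M,m) I + b_n (J − I)` with `a_n + (n−1) b_n = 0`, so Mg ⟺ `a_n(M,m)·n/(n−1) ≥ 8n·c′M⁴`-type scalar
inequalities for three explicit antiperiodic lattice sums `a_n` (one-loop vacuum polarisation − tadpole at `q ∈ {0,π}⁴`).
Numerics (lead c2, literal conventions): ratios `𝓗/(M⁴·S_cell-form) = 0.0402, 0.0312, 0.02548` at `M = 3`, `m = 0`
(`n = 2,3,4`; corner `/4 = 0.006370` = refuter scan `L = 6`), `0.02 (all n)` at `M = 1`, limit `≈ 0.02539`; so any
`c′ < 0.00317` works for large `M`. [difficulty: L — certified numerics of three 4D lattice sums + Riemann-sum control] -/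
theorem stub_hessianMargin : ∃ c' ε : ℝ, 0 < c' ∧ 0 < ε ∧ ∃ M₀ : ℕ, ∀ (M : ℕ) [NeZero M], M₀ ≤ M → ∀ (m : ℝ), |m| ≤ ε → ∀ (ω : Matrix.unitaryGroup (Fin 3) ℂ) (ζ : (Fin 4 → Fin M) → Fin 4 → Matrix.unitaryGroup (Fin 3) ℂ), ((ω : Matrix.unitaryGroup (Fin 3) ℂ) : Matrix (Fin 3) (Fin 3) ℂ) = Complex.exp (↑(Real.pi / (2 * M : ℕ)) * Complex.I) • (1 : Matrix (Fin 3) (Fin 3) ℂ) → (∀ k μ, ((ζ k μ : Matrix.unitaryGroup (Fin 3) ℂ) : Matrix (Fin 3) (Fin 3) ℂ) = Complex.exp (Real.pi * Complex.I * ((k μ : ℕ) : ℂ) / (M : ℂ)) • (1 : Matrix (Fin 3) (Fin 3) ℂ)) → let B0 : (Fin 4 → Fin M) → Matrix (TorusSite 4 2 × Fin 3 × Fin 4) (TorusSite 4 2 × Fin 3 × Fin 4) ℂ := fun k => wilsonDirac (unitaryFundamentalRep (Fin 3) ℂ) (fun e : Edge 4 2 => ζ k e.2 * ω) m 1; let Dl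 : (Fin 4 → Fin M) → (Edge 4 2 → Matrix (Fin 3) (Fin 3) ℂ) → Matrix (TorusSite 4 2 × Fin 3 × Fin 4) (TorusSite 4 2 × Fin 3 × Fin 4) ℂ := fun k E => Matrix.of fun p q => -(1 / 2 : ℂ) * ∑ μ : Fin 4, ((if q.1 = Site.shift p.1 μ then ((1 : Matrix (Fin 4) (Fin 4) ℂ) - euclideanGamma μ) p.2.2 q.2.2 * (((ζ k μ * ω : Matrix.unitaryGroup (Fin 3) ℂ) : Matrix (Fin 3) (Fin 3) ℂ) * E (p.1, μ)) p.2.1 q.2.1 else 0) + (if p.1 = Site.shift q.1 μ then ((1 : Matrix (Fin 4) (Fin 4) ℂ) + euclideanGamma μ) p.2.2 q.2.2 * (((ζ k μ * ω : Matrix.unitaryGroup (Fin 3) ℂ) : Matrix (Fin 3) (Fin 3) ℂ) * E (q.1, μ))ᴴ p.2.1 q.2.1 else 0)); let ell : (Fin 4 → Fin M) → (Edge 4 2 → Matrix (Fin 3) (Fin 3) ℂ) → ℝ := fun k E => ((B0 k)⁻¹ * Dl k E).trace.re; let bf : (Fin 4 → Fin M) → (Edge 4 2 → Matrix (Fin 3)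 (Fin 3) ℂ) → (Edge 4 2 → Matrix (Fin 3) (Fin 3) ℂ) → ℝ := fun k E₁ E₂ => ((B0 k)⁻¹ * Dl k E₁ * ((B0 k)⁻¹ * Dl k E₂)).trace.re; let tst : Fin 4 → (Edge 4 2 → Matrix (Fin 3) (Fin 3) ℂ) := fun μ e => if e = ((0 : TorusSite 4 2), μ) then (1 / 3 : ℂ) • (1 : Matrix (Fin 3) (Fin 3) ℂ) else 0; let T : Fin 4 → ℝ := fun μ => ∑ k : Fin 4 → Fin M, ell k (tst μ); ∀ Y : Edge 4 2 → Matrix (Fin 3) (Fin 3) ℂ, (∀ e, (Y e)ᴴ = -Y e) → (∀ (x : TorusSite 4 2) (μ : Fin 4), Y (Site.shift x μ, μ) = -Y (x, μ)) → c' * (M : ℝ) ^ 4 * (∑ p : Plaquette 4 2, ∑ a, ∑ b, ‖(Y (p.1, p.2.1.1) + Y (Site.shift p.1 p.2.1.1, p.2.1.2) - Y (Site.shift p.1 p.2.1.2, p.2.1.1) - Y (p.1, p.2.1.2)) a b‖ ^ 2) ≤ (∑ k : Fin 4 → Fin M, bf k Y Y) / 2 + (∑ μ : Fin 4, T μ *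 ∑ x : TorusSite 4 2, ∑ a, ∑ b, ‖Y (x, μ) a b‖ ^ 2) / 2 :=
  stub_hessianMarginOfStubsV2 stub_wardKernel stub_gaugeCoercive stub_massLipschitz stub_twistCounting stub_cornerCounting
    stub_blockMargin0 stub_blockMargin1 stub_blockMargin2 stub_blockMargin3a stub_blockMargin3b

end Summit.QuantumFields.QCD.Cruxes.CriticalLineDiamagnetism.ChessboardCellGain

end
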